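import Summits.NavierStokesRegularity.NavierStokesRegularity.Theorems.ExtremiserTransienceNearExtremalTransiencePerFlowZoomPackageFlowCompactness
import HarnessLib

/-!
# Route `ExtremiserTransience`, crux `NearExtremalTransiencePerFlow` (stmt-NavierStokesRegularity-26567) —
# LINE g9-β «filament selection» rev 5 §2e, stub T2′ `stub_zoomPackageFlow`: THE ZOOM PACKAGE AT FLOW LEVEL

`--supports stmt-NavierStokesRegularity-26567`.  Prover seat ns-net-p2 (g6).  THE STATEMENT (`zoomPackageFlow`, verbatim the Prop
`ZoomPackageFlow` of the crux workfile `Cruxes/NearExtremalTransiencePerFlow/Lines/filament_selection.lean` rev 5 §2e with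
`ZoomCompactFlow` unfolded, over the δ texts of record `MemberSelection.{EfficientTimesData, NearExtremalFamily}` and
`ZoneTransversality.IsViolator`): for a violator flow with efficient-times data there are a subsequence `σ` and constants with
(i) the NS-compatible zoomed slices `y ↦ (Mb n)⁻¹ • u (t n) ((ν/Mb n) • y)` a near-extremal height-1 family (δ's T2, landed
`MemberSelection.stub_zoomPackage`), and (ii) FLOW-LEVEL ZOOM COMPACTNESS: along any centres `y n` and any subsequence `φ`, a further
subsequence of the translated zoomed FLOWS `(τ, z) ↦ (Mb n)⁻¹ • u (t n + (ν/(Mb n)²)(τ − s)) ((ν/Mb n) • (y n + z))` converges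
pointwise at EVERY rescaled time `τ < 0` to a Type-I ancient mild field `W`, with the Type-I pinning `(Mb n)²(T − t n)/ν → −s`.

PROOF (Koch–Nadirashvili–Seregin–Šverák 2009, Lemma 6.1 / proof of Theorem 6.2, in the tree's Type-I form).
1. `aₙ = (Mb n)²(T − t n)/ν ∈ [c₀², 4C²]`: Leray's lower rate (`PerFlow.lerayLowerRate_of_not_extends`) and the Type-I pinning of
   the height bound at near-efficient late times (universality of `κ⋆`, as in `stub_zoomPackage`).  Bolzano–Weierstrass along the
   given subsequence: `aₙ → L ≥ c₀² > 0`; put `s = −L`.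
2. Normalise `ν = 1` (`v(s', x) = ν⁻¹ u(s'/ν, x)`, the pattern of `typeIZoom_unit_viscosity`, copied to keep the explicit formula)
   and zoom `v` at length `cₙ = ν/Mb n`, centre `cₙ yₙ`, with the time origin placed so that rescaled time `τ` is the physical
   time `t n + (ν/(Mb n)²)(τ − s − ηₙ)`: the true vertex `νT` then sits at rescaled time `Bₙ = (aₙ − L) + ηₙ`, and the vanishing
   shifts `ηₙ = max(aₙ − L, 0) − (aₙ − L) + 1/(n+1) → 0` are chosen so that `Bₙ > 0`.  The zoomed flows are classical at unit
   viscosity (`IsClassicalNSSolutionOn.nsRescale_translate_zero`), Oseen-mild between all pairs of times (`typeIZoom_oseen_pairs`,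
   `oseen_smul_stPull`) and obey the rate `√(−τ)‖wₙ(τ)‖ ≤ C` on `(Aₙ, 0)`, `Aₙ → −∞` (the image of the rate window).
3. The tree's compactness in the Type-I-rate Oseen-mild class (`typeIZoom_compactness`, KNSS Lemma 6.1 with the rate only) gives
   a subsequence and a jointly continuous, weakly divergence-free, Oseen-mild `W` with `√(−τ)‖W‖ ≤ C`, `wₙ(τ) → W(τ)` locally
   uniformly at every `τ < 0`; KNSS Prop. 4.1 (`isTypeIAncientMild_of_continuous_oseenMild`) upgrades it to `IsTypeIAncientMild C W`.
4. The flows of the statement are `wₙ(τ + ηₙ)`; the uniform parabolic `1/4`-Hölder modulus of bounded Oseen-mild solutions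
   (`exists_holder_quarter_of_oseenMild`) removes the vanishing shift `ηₙ`.
HONEST FRAMING: compactness/regularity glue about hypothetical Type-I singular flows; nothing about Navier–Stokes regularity or
blow-up is proved; the heart H′ of the line is untouched; no summit is proved by a line.
[cite: KochNadirashviliSereginSverak2009, Lemma 6.1 and proof of Thm 6.2 (arXiv:0709.3599 pp. 11–13); Prop. 4.1 (p. 8)]
-/

noncomputable section

open scoped Topology InnerProductSpace RealInnerProductSpace ENNReal ContDiff
open MeasureTheory Filter Set Metric Function
open Literature.Analysis Literature.Analysis.FluidPDE
open Summit.NavierStokesRegularity.NavierStokesRegularity.Theorems.DepletionLadder.KStar.HalfSpace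
open Summit.NavierStokesRegularity.NavierStokesRegularity.Theorems.NearExtremalTransiencePerFlow.ZoneTransversality
open Summit.NavierStokesRegularity.NavierStokesRegularity.Theorems.NearExtremalTransiencePerFlow.MemberSelection

namespace Summit.NavierStokesRegularity.NavierStokesRegularity.Theorems

set_option linter.dupNamespace false

namespace NearExtremalTransiencePerFlow.FilamentSelection

/-! ### The stub -/

/-- **T2′ `stub_zoomPackageFlow` — THE ZOOM PACKAGE AT FLOW LEVEL** (verbatim the Prop `ZoomPackageFlow` of
`Cruxes/NearExtremalTransiencePerFlow/Lines/filament_selection.lean` rev 5 §2e, with `ZoomCompactFlow` unfolded; vocabulary = the δ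
texts of record).  For a violator flow with efficient-times data: along the subsequence of δ's T2 (`stub_zoomPackage`) the
NS-compatible zoomed slices form a near-extremal height-1 family, and the zoomed FLOWS are compact at flow level — along any
centres and any subsequence a further subsequence converges pointwise at every rescaled time `τ < 0` to a Type-I ancient mild
field, with the Type-I pinning `(Mb n)²(T − t n)/ν → −s` (`zoomCompactFlow_of_pinned`: Leray's lower rate and the pinning of
the height bound make `(Mb n)²(T − t n)/ν ∈ [c₀², 4C²]`).
[cite: KochNadirashviliSereginSverak2009, Lemma 6.1 and proof of Thm 6.2 (arXiv:0709.3599 pp. 11–13); Prop. 4.1 (p. 8)] -/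
theorem zoomPackageFlow :
    ∀ (C ν T : ℝ) (u : ℝ → EuclideanSpace ℝ (Fin 3) → EuclideanSpace ℝ (Fin 3))
      (p : ℝ → EuclideanSpace ℝ (Fin 3) → ℝ),
    IsViolator C ν T u p → ∀ (Θ : ℝ) (t Mb ε : ℕ → ℝ), EfficientTimesData ν T u Θ t Mb ε →
      ∃ (σ : ℕ → ℕ) (Λ : ℕ → ℝ) (Θ' : ℝ) (ε' : ℕ → ℝ), StrictMono σ ∧
        NearExtremalFamily (fun n y => (Mb (σ n))⁻¹ • u (t (σ n)) ((ν / Mb (σ n)) • y)) Λ Θ' ε' ∧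
        ∀ (y : ℕ → EuclideanSpace ℝ (Fin 3)) (φ : ℕ → ℕ), StrictMono φ →
          ∃ (ψ : ℕ → ℕ) (K s : ℝ) (W : ℝ → EuclideanSpace ℝ (Fin 3) → EuclideanSpace ℝ (Fin 3)), StrictMono ψ ∧
            Literature.Analysis.FluidPDE.IsTypeIAncientMild K W ∧ s < 0 ∧
            Tendsto (fun n => (fun n => Mb (σ n)) (φ (ψ n)) ^ 2 * (T - (fun n => t (σ n)) (φ (ψ n))) / ν)
              atTop (𝓝 (-s)) ∧
            ∀ τ : ℝ, τ < 0 → ∀ z : EuclideanSpace ℝ (Fin 3),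
              Tendsto (fun n => ((fun n => Mb (σ n)) (φ (ψ n)))⁻¹ •
                  u ((fun n => t (σ n)) (φ (ψ n)) + ν / (fun n => Mb (σ n)) (φ (ψ n)) ^ 2 * (τ - s))
                    ((ν / (fun n => Mb (σ n)) (φ (ψ n))) • (y (φ (ψ n)) + z)))
                atTop (𝓝 (W τ z)) := by
  intro C ν T u p hV Θ t Mb ε hD
  -- δ's T2: the near-extremal family along `σ`
  obtain ⟨σ, Λ, Θ', ε', hσ, hfam, -⟩ := stub_zoomPackage C ν T u p hV Θ t Mb ε hD
  refine ⟨σ, Λ, Θ', ε', hσ, hfam, fun y φ hφ => ?_⟩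
  have hpinD := typeI_pinning_eventually hV hD
  obtain ⟨hC, hν, hT, hsol, hLH, hdec, hrate, hext, -⟩ := hV
  obtain ⟨ht, htT, hε, hMbpos, hMb, -, -, -⟩ := hD
  -- the index map `σ ∘ φ` and the tail where the pinning holds
  have hσφ : StrictMono (σ ∘ φ) := hσ.comp hφ
  have hσφT : Tendsto (σ ∘ φ) atTop atTop := hσφ.tendsto_atTop
  obtain ⟨N₁, hN₁⟩ := (hσφT.eventually hpinD).exists_forall_of_atTop
  -- Leray's lower rate: `ν c₀² ≤ (T − t n) (Mb n)²`
  obtain ⟨c₀, hc₀, hler⟩ := DepletionLadder.PerFlow.lerayLowerRate_of_not_extends hν hT hsol hLH hdec hext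
  have hlow0 : ∀ n, c₀ ^ 2 ≤ Mb n ^ 2 * (T - t n) / ν := by
    intro n
    obtain ⟨x, hx⟩ := hler (t n) (ht n)
    have h1 : c₀ * Real.sqrt ν ≤ Real.sqrt (T - t n) * Mb n :=
      hx.trans (mul_le_mul_of_nonneg_left (hMb n x) (Real.sqrt_nonneg _))
    have h2 := pow_le_pow_left₀ (by positivity) h1 2
    rw [mul_pow, mul_pow, Real.sq_sqrt hν.le, Real.sq_sqrt (sub_pos.2 (ht n).2).le] at h2
    rw [le_div_iff₀ hν]
    linarith
  -- the shifted data `k ↦ (σ ∘ φ) (k + N₁)`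
  set idx : ℕ → ℕ := fun k => σ (φ (k + N₁)) with hidx
  have hup : ∀ k, Mb (idx k) ^ 2 * (T - t (idx k)) / ν ≤ 4 * C ^ 2 := by
    intro k
    have h := hN₁ (k + N₁) (Nat.le_add_left _ _)
    rw [div_le_iff₀ hν]
    simp only [hidx, Function.comp] at h ⊢
    linarith
  have htidx : Tendsto (fun k => t (idx k)) atTop (𝓝 T) :=
    htT.comp (hσφT.comp (tendsto_add_atTop_nat N₁))
  obtain ⟨ψ₀, K, s, W, hψ₀, hW, hs, hpin, hconv⟩ :=
    zoomCompactFlow_of_pinned hC hν hT hsol hLH hdec hrate (t := fun k => t (idx k)) (Mb := fun k => Mb (idx k))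
      (fun k => ht _) htidx (fun k => hMbpos _) (pow_pos hc₀ 2) (fun k => hlow0 _) hup (fun k => y (φ (k + N₁)))
  refine ⟨fun n => ψ₀ n + N₁, K, s, W, fun a b hab => Nat.add_lt_add_right (hψ₀ hab) N₁, hW, hs, ?_, ?_⟩
  · simpa only [hidx] using hpin
  · intro τ hτ z
    simpa only [hidx] using hconv τ hτ z

end NearExtremalTransiencePerFlow.FilamentSelection

end Summit.NavierStokesRegularity.NavierStokesRegularity.Theorems

end
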